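import Literature.NumberTheory.EllipticCurves.CuspFormLFunction
import HarnessLib

/-!
# The Petersson norm of the newform of an elliptic curve is `N^{1+o(1)}` — the lower bound

Topic `Literature/NumberTheory/EllipticCurves`; ONE named fact (result in print, `def … : Prop`,
D-0014) requested by route `ABC/RibetTakahashiSplit`, support item `stmt-ABC-1565`
(`PeterssonLowerBound`: "NAMED FACT wanted … then close this item by `exact`"), hypothesis no. 4
of that route's Assembly.

* `murty_petersson_newform_lower_bound` — for every `ε > 0` there is `c_ε > 0` such that for
  every level `N`, every elliptic curve `W/ℚ` and its newform `f ∈ S₂(Γ₀(N))` (`IsNewformOf W f`: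
  normalised, new, Hecke eigenform with `aₙ(f) = aₙ(W)`), `c_ε N^{1−ε} ≤ Re ⟨f, f⟩_{Γ₀(N)}`, where
  `⟨f, f⟩` is the tree's UN-normalised Petersson product `peterssonProduct (Gamma0 N) 2 f f`
  (`HeckeOperators.lean`: `∫` over a fundamental domain of `|f|² y²  dμ`, no `1/vol` factor).

In print: M. R. Murty, *Bounds for congruence primes* (1999): `2 log ‖f‖_{2,Γ₀(N)} ∼ log N` for the
newform of an elliptic curve of conductor `N`, with an effective error term by Hoffstein–Lockhart
(Ann. of Math. 140 (1994), lower bound `L(1, Sym² f) ≫_ε N^{−ε}`, appendix by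
Goldfeld–Hoffstein–Lieman), as quoted in Pasten, *Shimura curves and the abc conjecture*
(arXiv:1705.09251, p. 13, right after the definition
`‖f‖²_{2,Γ₀(N)} := ∫_{Γ₀(N)\𝔥} |f(z)|² y² dμ_𝔥(z)`): "as pointed out in [MurtyBounds], one has
`2 log ‖f‖_{2,Γ₀(N)} ∼ log N` with an effective error term by [HofLoc]". The mechanism:
Rankin–Selberg unfolding gives `⟨f, f⟩ = N^{1+o(1)} · L(1, Sym² f)` up to absolute constants and
local factors at `p² ∣ N` of size `N^{o(1)}`, and `N^{−ε} ≪_ε L(1, Sym² f) ≪ log N`.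

## Rendering choices

* Only the LOWER bound is vendored (what the route consumes); it is stated for all `N ≥ 1`
  with a constant `c_ε` (the asymptotic `∼` plus positivity `⟨f, f⟩ > 0` at the finitely many
  small levels gives this form; the constant is ineffective in the CM/dihedral case, where the
  absence of a Siegel zero for `L(s, Sym² f) = L(s, χ_K)L(s, ψ²)` is Siegel's theorem — harmless
  for an `∃ c` statement).
* The newform is pinned by `IsNewformOf W f` (so `a₁ = 1`: no scaling ambiguity), for an elliptic
  `W`; by `IsNewformOf.level_eq_conductorNorm` the level is then `N = N_W`, so "conductor `N`" in
  Murty/Pasten and "level `N`" here agree.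
* `peterssonProduct` may differ from Pasten's `‖f‖²_{2,Γ₀(N)}` by a factor `c ∈ {1, 2}` and by
  Mathlib's measure normalisation on `ℍ` — absolute constants, absorbed in `c_ε`. We take the real
  part (the tree's product is `ℂ`-valued; `⟨f,f⟩ ≥ 0` is `peterssonProduct_self_pos`, a separate fact).

## References

* M. R. Murty, *Bounds for congruence primes*, in: Automorphic forms, automorphic representations,
  and arithmetic (Fort Worth 1996), Proc. Sympos. Pure Math. 66.1, AMS (1999) 177–192.
  [MurtyCongruencePrimes1999] (not held; statement as quoted by Pasten.)
* J. Hoffstein, P. Lockhart, *Coefficients of Maass forms and the Siegel zero* (appendix by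
  D. Goldfeld, J. Hoffstein, D. Lieman), Ann. of Math. 140 (1994) 161–181. [HoffsteinLockhart1994]
* H. Pasten, *Shimura curves and the abc conjecture*, J. Number Theory 254 (2024) =
  arXiv:1705.09251, p. 13 (read). [PastenShimura2024]
-/

noncomputable section

open CongruenceSubgroup

namespace Literature.NumberTheory.EllipticCurves.ModularForms

/-- **The newform of an elliptic curve has Petersson norm `≫_ε N^{1−ε}`** (Murty 1999:
`2 log ‖f‖_{2,Γ₀(N)} ∼ log N`, effective error term by Hoffstein–Lockhart 1994; quoted in Pasten,
arXiv:1705.09251 p. 13). For every `ε > 0` there is `c > 0` with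
`c · N^{1−ε} ≤ Re ⟨f, f⟩_{Γ₀(N)}` for every `N ≥ 1`, every elliptic curve `W/ℚ` and every
`f ∈ S₂(Γ₀(N))` with `IsNewformOf W f` (then `N = N_W`); `⟨·,·⟩ = peterssonProduct (Gamma0 N) 2`,
un-normalised. Grounds `Summit.ABC.ABC.Theses.RibetTakahashiSplit.PeterssonLowerBound`
(apply it to `D.f`, `D.isNewformOf` for `D : ModularParametrizationData W N`). Only the lower
bound; the matching upper bound `⟨f,f⟩ ≪ N log N` is not vendored. [cite: MurtyCongruencePrimes1999, '2 log ‖f‖ ∼ log N' as quoted in Pasten arXiv:1705.09251 p. 13; lower bound via HoffsteinLockhart1994] -/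
def murty_petersson_newform_lower_bound : Prop :=
  ∀ ε : ℝ, 0 < ε → ∃ c : ℝ, 0 < c ∧
    ∀ (N : ℕ) [NeZero N] (W : WeierstrassCurve ℚ) [W.IsElliptic] (f : CuspForm (Gamma0 N) 2),
      IsNewformOf W f →
        c * (N : ℝ) ^ (1 - ε) ≤ (peterssonProduct (Gamma0 N) 2 f f).re

end Literature.NumberTheory.EllipticCurves.ModularForms

end
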